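import Mathlib
import Literature.Analysis.Matrix.QuadraticCombesThomas
import HarnessLib

/-!
# A local dimension bound below a local floor (IMS localisation and Schur's test)

Topic `Literature/Analysis/Matrix`; namespace `Literature.Analysis.Matrix`.  Everything here is
PROVED (no definitions, no named facts).

Setting.  `σ` is a finite set of sites with an `ℕ`-valued, symmetric `dist` satisfying the
triangle inequality, `κ` a finite set of internal indices, and `A : Matrix (σ × κ) (σ × κ) ℂ` a
matrix of RANGE ONE in the sites (`A p q ≠ 0 → dist p.1 q.1 ≤ 1`) whose absolute row and column
sums over `{q | dist p.1 q.1 ≠ 0}` are at most `h`.  A LOCAL FLOOR is the hypothesis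
`F Σ|w_p|² ≤ Σ|(Aw)_p|²` for every `w` supported on sites at distance `> r` from every "rough"
site.  Conclusion (`exists_finrank_le_card_of_localFloor`): every subspace `E` of vectors
supported in a site set `Z` on which `Σ|(Av)_p|² ≤ τ Σ|v_p|²` with the numerical gap
`2τ + 2(h/ℓ)² < F` has `dim E ≤ |κ| · #{x ∈ Z | ∃ y rough, dist x y < r + ℓ}` — the rank of the
sub-threshold block is carried by the `(r + ℓ)`-collar of the rough set, with no dependence on
`|σ|` (a volume-free, Dirichlet-form Cwikel–Lieb–Rozenblum-type count in which the local floor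
replaces the kinetic energy).

Proof (IMS localisation, as in Cycon–Froese–Kirsch–Simon §3.1, in finite dimensions).  Let
`χ : σ → [0, 1]` be `(1/ℓ)`-Lipschitz for `dist`, `= 0` within distance `r` of the rough set and
`= 1` off its `(r + ℓ)`-collar (`exists_lipschitz_cutoff`, the clamped distance to the rough
set).  The commutator `[A, χ]` has entries `A_{pq}(χ(q) − χ(p))`, of modulus `≤ |A_{pq}|/ℓ` and
vanishing where `dist = 0`, so Schur's test gives `‖[A, χ]v‖² ≤ (h/ℓ)²‖v‖²`
(`sum_norm_sq_commutator_mulVec_le`), whence `‖A(χv)‖² ≤ 2‖Av‖² + 2(h/ℓ)²‖v‖²`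
(`sum_norm_sq_mulVec_cutoff_le`).  If `v ∈ E` vanishes on `{χ < 1} ∩ Z` then `χv = v`, and the
floor gives `F‖v‖² ≤ (2τ + 2(h/ℓ)²)‖v‖²`, so `v = 0` (`eq_zero_of_localFloor_of_cutoff`): the
restriction map `E → ({χ < 1} ∩ Z) × κ → ℂ` is injective and `dim E ≤ |κ| · #({χ < 1} ∩ Z)`
(`finrank_le_card_of_forall_eq_zero`).

References: IMS localisation formula — Cycon, Froese, Kirsch, Simon, *Schrödinger operators*,
§3.1; Schur's test — Horn–Johnson §5.6 (`sum_norm_sq_mulVec_le_of_rowSum_le_of_colSum_le`).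
Not here: any optimisation of constants, operator-norm (rather than quadratic-form) statements,
infinite index sets.
-/

noncomputable section

open Finset
open scoped Matrix

namespace Literature.Analysis.Matrix

/-! ### Dimension from an injective restriction -/

section Finrank

variable {K ι : Type*} [Field K] [Fintype ι]

/-- If every `v ∈ E` vanishing on the index set `S` vanishes identically (the restriction map
`E → (S → K)` is injective), then `dim E ≤ #S`. [folklore] -/
theorem finrank_le_card_of_forall_eq_zero (E : Submodule K (ι → K)) (S : Finset ι)
    (hS : ∀ v ∈ E, (∀ i ∈ S, v i = 0) → v = 0) : Module.finrank K E ≤ S.card := by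
  classical
  let f : E →ₗ[K] (S → K) := (LinearMap.funLeft K K (Subtype.val : S → ι)).comp E.subtype
  have hf : Function.Injective f := by
    rw [← LinearMap.ker_eq_bot, LinearMap.ker_eq_bot']
    intro v hv
    have h0 : (v : ι → K) = 0 := hS v v.2 fun i hi => by
      have := congrFun hv ⟨i, hi⟩
      simpa [f] using this
    exact (Submodule.coe_eq_zero).mp h0
  calc Module.finrank K E ≤ Module.finrank K (S → K) :=
        LinearMap.finrank_le_finrank_of_injective hf
    _ = S.card := by rw [Module.finrank_fintype_fun_eq_card, Fintype.card_coe]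

end Finrank

/-! ### The commutator with a Lipschitz cutoff: Schur bound and the IMS estimate -/

section Cutoff

variable {σ κ : Type*} [Fintype σ] [Fintype κ]

omit [Fintype σ] [Fintype κ] in
/-- Entries of the commutator `[A, χ]` for a range-one `A` and an `η`-Lipschitz `χ`:
`|A_{pq}(χ(q) − χ(p))| ≤ η · 𝟙[dist(p,q) ≠ 0] · |A_{pq}|`. [folklore] -/
theorem norm_mul_ofReal_sub_le_of_lipschitz (dist : σ → σ → ℕ) (A : Matrix (σ × κ) (σ × κ) ℂ)
    (hrange : ∀ p q, A p q ≠ 0 → dist p.1 q.1 ≤ 1) (χ : σ → ℝ) {η : ℝ} (hη : 0 ≤ η)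
    (hχ : ∀ x y, |χ y - χ x| ≤ η * dist x y) (p q : σ × κ) :
    ‖A p q * ((χ q.1 - χ p.1 : ℝ) : ℂ)‖ ≤ η * (if dist p.1 q.1 ≠ 0 then ‖A p q‖ else 0) := by
  rw [norm_mul, Complex.norm_real, Real.norm_eq_abs]
  have hpq := hχ p.1 q.1
  by_cases hd : dist p.1 q.1 = 0
  · rw [hd, Nat.cast_zero, mul_zero] at hpq
    rw [if_neg (not_not.mpr hd), mul_zero]
    exact (mul_le_mul_of_nonneg_left hpq (norm_nonneg _)).trans (le_of_eq (mul_zero _))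
  · rw [if_pos hd]
    by_cases hA : A p q = 0
    · simp [hA]
    · have h1 : (dist p.1 q.1 : ℝ) ≤ 1 := by exact_mod_cast hrange p q hA
      rw [mul_comm]
      refine mul_le_mul_of_nonneg_right (hpq.trans ?_) (norm_nonneg _)
      calc η * (dist p.1 q.1 : ℝ) ≤ η * 1 := mul_le_mul_of_nonneg_left h1 hη
        _ = η := mul_one η

/-- **Schur bound for the commutator with a Lipschitz cutoff.**  If `A` has range one in the
sites, off-site absolute row and column sums `≤ h`, and `χ` is `η`-Lipschitz for `dist`, then
`Σ_p |Σ_q A_{pq}(χ(q) − χ(p)) v_q|² ≤ (ηh)² Σ_q |v_q|²`, i.e. `‖[A, χ]‖ ≤ ηh`. [folklore] -/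
theorem sum_norm_sq_commutator_mulVec_le (dist : σ → σ → ℕ) (A : Matrix (σ × κ) (σ × κ) ℂ)
    (hrange : ∀ p q, A p q ≠ 0 → dist p.1 q.1 ≤ 1) (h : ℝ) (hh : 0 ≤ h)
    (hrow : ∀ p, ∑ q ∈ univ.filter (fun q => dist p.1 q.1 ≠ 0), ‖A p q‖ ≤ h)
    (hcol : ∀ q, ∑ p ∈ univ.filter (fun p => dist p.1 q.1 ≠ 0), ‖A p q‖ ≤ h)
    (χ : σ → ℝ) {η : ℝ} (hη : 0 ≤ η) (hχ : ∀ x y, |χ y - χ x| ≤ η * dist x y)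
    (v : σ × κ → ℂ) :
    ∑ p, ‖∑ q, A p q * ((χ q.1 - χ p.1 : ℝ) : ℂ) * v q‖ ^ 2 ≤
      (η * h) ^ 2 * ∑ q, ‖v q‖ ^ 2 := by
  set K : Matrix (σ × κ) (σ × κ) ℂ :=
    Matrix.of fun p q => A p q * ((χ q.1 - χ p.1 : ℝ) : ℂ) with hK
  have hKle : ∀ p q, ‖K p q‖ ≤ η * (if dist p.1 q.1 ≠ 0 then ‖A p q‖ else 0) := fun p q => by
    simp only [hK, Matrix.of_apply]
    exact norm_mul_ofReal_sub_le_of_lipschitz dist A hrange χ hη hχ p q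
  have hsum : ∀ (f g : σ × κ → ℝ) (nz : σ × κ → Prop) [DecidablePred nz],
      (∀ k, f k ≤ η * (if nz k then g k else 0)) →
        ∑ k ∈ univ.filter nz, g k ≤ h → ∑ k, f k ≤ η * h := by
    intro f g nz _ hf hb
    calc ∑ k, f k ≤ ∑ k, η * (if nz k then g k else 0) := sum_le_sum fun k _ => hf k
      _ = η * ∑ k ∈ univ.filter nz, g k := by rw [← mul_sum, sum_filter]
      _ ≤ η * h := mul_le_mul_of_nonneg_left hb hη
  have hKv : ∀ p, (K *ᵥ v) p = ∑ q, A p q * ((χ q.1 - χ p.1 : ℝ) : ℂ) * v q := fun p => by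
    simp only [hK, Matrix.mulVec, dotProduct, Matrix.of_apply]
  calc ∑ p, ‖∑ q, A p q * ((χ q.1 - χ p.1 : ℝ) : ℂ) * v q‖ ^ 2 = ∑ p, ‖(K *ᵥ v) p‖ ^ 2 := by
        simp only [hKv]
    _ ≤ η * h * (η * h) * ∑ q, ‖v q‖ ^ 2 :=
        sum_norm_sq_mulVec_le_of_rowSum_le_of_colSum_le K (mul_nonneg hη hh)
          (fun p => hsum _ _ _ (fun q => hKle p q) (hrow p))
          (fun q => hsum _ _ _ (fun p => hKle p q) (hcol q)) v
    _ = (η * h) ^ 2 * ∑ q, ‖v q‖ ^ 2 := by rw [pow_two]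

/-- **The IMS estimate.**  With `A`, `χ` as in `sum_norm_sq_commutator_mulVec_le` and
`|χ| ≤ 1`: `‖A(χv)‖² ≤ 2‖Av‖² + 2(ηh)²‖v‖²` (from `A(χv) = χ·Av + [A, χ]v`). [folklore] -/
theorem sum_norm_sq_mulVec_cutoff_le (dist : σ → σ → ℕ) (A : Matrix (σ × κ) (σ × κ) ℂ)
    (hrange : ∀ p q, A p q ≠ 0 → dist p.1 q.1 ≤ 1) (h : ℝ) (hh : 0 ≤ h)
    (hrow : ∀ p, ∑ q ∈ univ.filter (fun q => dist p.1 q.1 ≠ 0), ‖A p q‖ ≤ h)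
    (hcol : ∀ q, ∑ p ∈ univ.filter (fun p => dist p.1 q.1 ≠ 0), ‖A p q‖ ≤ h)
    (χ : σ → ℝ) (hχ1 : ∀ x, |χ x| ≤ 1) {η : ℝ} (hη : 0 ≤ η)
    (hχ : ∀ x y, |χ y - χ x| ≤ η * dist x y) (v : σ × κ → ℂ) :
    ∑ p, ‖(A *ᵥ fun q => (χ q.1 : ℂ) * v q) p‖ ^ 2 ≤
      2 * ∑ p, ‖(A *ᵥ v) p‖ ^ 2 + 2 * (η * h) ^ 2 * ∑ q, ‖v q‖ ^ 2 := by
  have hsplit : ∀ p, (A *ᵥ fun q => (χ q.1 : ℂ) * v q) p =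
      (χ p.1 : ℂ) * (A *ᵥ v) p + ∑ q, A p q * ((χ q.1 - χ p.1 : ℝ) : ℂ) * v q := by
    intro p
    simp only [Matrix.mulVec, dotProduct, Finset.mul_sum, ← Finset.sum_add_distrib]
    refine Finset.sum_congr rfl fun q _ => ?_
    push_cast
    ring
  have hpt : ∀ p, ‖(A *ᵥ fun q => (χ q.1 : ℂ) * v q) p‖ ^ 2 ≤
      2 * ‖(A *ᵥ v) p‖ ^ 2 + 2 * ‖∑ q, A p q * ((χ q.1 - χ p.1 : ℝ) : ℂ) * v q‖ ^ 2 := by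
    intro p
    rw [hsplit p]
    set a : ℂ := (χ p.1 : ℂ) * (A *ᵥ v) p with ha
    set b : ℂ := ∑ q, A p q * ((χ q.1 - χ p.1 : ℝ) : ℂ) * v q with hb
    have h1 : ‖a + b‖ ≤ ‖a‖ + ‖b‖ := norm_add_le a b
    have h2 : ‖a‖ ≤ ‖(A *ᵥ v) p‖ := by
      rw [ha, norm_mul, Complex.norm_real, Real.norm_eq_abs]
      exact (mul_le_mul_of_nonneg_right (hχ1 p.1) (norm_nonneg _)).trans (le_of_eq (one_mul _))
    have h3 : ‖a + b‖ ^ 2 ≤ (‖a‖ + ‖b‖) ^ 2 := pow_le_pow_left₀ (norm_nonneg _) h1 2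
    have h4 : ‖a‖ ^ 2 ≤ ‖(A *ᵥ v) p‖ ^ 2 := pow_le_pow_left₀ (norm_nonneg _) h2 2
    nlinarith [sq_nonneg (‖a‖ - ‖b‖)]
  calc ∑ p, ‖(A *ᵥ fun q => (χ q.1 : ℂ) * v q) p‖ ^ 2 ≤
      ∑ p, (2 * ‖(A *ᵥ v) p‖ ^ 2 +
        2 * ‖∑ q, A p q * ((χ q.1 - χ p.1 : ℝ) : ℂ) * v q‖ ^ 2) := sum_le_sum fun p _ => hpt p
    _ = 2 * ∑ p, ‖(A *ᵥ v) p‖ ^ 2 +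
        2 * ∑ p, ‖∑ q, A p q * ((χ q.1 - χ p.1 : ℝ) : ℂ) * v q‖ ^ 2 := by
        rw [sum_add_distrib, mul_sum, mul_sum]
    _ ≤ 2 * ∑ p, ‖(A *ᵥ v) p‖ ^ 2 + 2 * ((η * h) ^ 2 * ∑ q, ‖v q‖ ^ 2) := by
        have := sum_norm_sq_commutator_mulVec_le dist A hrange h hh hrow hcol χ hη hχ v
        linarith
    _ = _ := by ring

/-- **No mass where the cutoff is `1`.**  If, in addition, the local floor
`F Σ|w_p|² ≤ Σ|(Aw)_p|²` holds for every `w` supported in `{χ ≠ 0}`, `0 ≤ χ ≤ 1`, and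
`2τ + 2(ηh)² < F`, then a vector `v` with `Σ|(Av)_p|² ≤ τ Σ|v_p|²` that is supported in `{χ = 1}`
vanishes: `F‖v‖² = F‖χv‖² ≤ ‖A(χv)‖² ≤ (2τ + 2(ηh)²)‖v‖²`. [folklore] -/
theorem eq_zero_of_localFloor_of_cutoff (dist : σ → σ → ℕ) (A : Matrix (σ × κ) (σ × κ) ℂ)
    (hrange : ∀ p q, A p q ≠ 0 → dist p.1 q.1 ≤ 1) (h : ℝ) (hh : 0 ≤ h)
    (hrow : ∀ p, ∑ q ∈ univ.filter (fun q => dist p.1 q.1 ≠ 0), ‖A p q‖ ≤ h)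
    (hcol : ∀ q, ∑ p ∈ univ.filter (fun p => dist p.1 q.1 ≠ 0), ‖A p q‖ ≤ h)
    (χ : σ → ℝ) (hχ01 : ∀ x, 0 ≤ χ x ∧ χ x ≤ 1) {η : ℝ} (hη : 0 ≤ η)
    (hχ : ∀ x y, |χ y - χ x| ≤ η * dist x y) (F τ : ℝ) (hgap : 2 * τ + 2 * (η * h) ^ 2 < F)
    (hfloor : ∀ w : σ × κ → ℂ, (∀ p, w p ≠ 0 → χ p.1 ≠ 0) →
      F * ∑ p, ‖w p‖ ^ 2 ≤ ∑ p, ‖(A *ᵥ w) p‖ ^ 2)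
    (v : σ × κ → ℂ) (hv : ∑ p, ‖(A *ᵥ v) p‖ ^ 2 ≤ τ * ∑ p, ‖v p‖ ^ 2)
    (hv1 : ∀ p, v p ≠ 0 → χ p.1 = 1) : v = 0 := by
  set w : σ × κ → ℂ := fun q => (χ q.1 : ℂ) * v q with hw
  have hwv : ∀ p, ‖w p‖ = ‖v p‖ := by
    intro p
    by_cases hp : v p = 0
    · simp [hw, hp]
    · simp [hw, hv1 p hp]
  have hwsupp : ∀ p, w p ≠ 0 → χ p.1 ≠ 0 := by
    intro p hp hχ0
    apply hp
    simp [hw, hχ0]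
  have h1 := hfloor w hwsupp
  have h2 := sum_norm_sq_mulVec_cutoff_le dist A hrange h hh hrow hcol χ
    (fun x => abs_le.mpr ⟨by linarith [(hχ01 x).1, (hχ01 x).2], (hχ01 x).2⟩) hη hχ v
  have hS : ∑ p, ‖w p‖ ^ 2 = ∑ p, ‖v p‖ ^ 2 := Finset.sum_congr rfl fun p _ => by rw [hwv]
  rw [hS] at h1
  have hS0 : 0 ≤ ∑ p, ‖v p‖ ^ 2 := Finset.sum_nonneg fun p _ => by positivity
  have hA0 : 0 ≤ ∑ p, ‖(A *ᵥ v) p‖ ^ 2 := Finset.sum_nonneg fun p _ => by positivity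
  have h3 : F * ∑ p, ‖v p‖ ^ 2 ≤ (2 * τ + 2 * (η * h) ^ 2) * ∑ p, ‖v p‖ ^ 2 := by
    calc F * ∑ p, ‖v p‖ ^ 2 ≤ ∑ p, ‖(A *ᵥ w) p‖ ^ 2 := h1
      _ ≤ 2 * ∑ p, ‖(A *ᵥ v) p‖ ^ 2 + 2 * (η * h) ^ 2 * ∑ q, ‖v q‖ ^ 2 := h2
      _ ≤ 2 * (τ * ∑ p, ‖v p‖ ^ 2) + 2 * (η * h) ^ 2 * ∑ q, ‖v q‖ ^ 2 := by linarith
      _ = _ := by ring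
  have hSle : ∑ p, ‖v p‖ ^ 2 ≤ 0 := by
    by_contra hlt
    nlinarith [mul_pos (sub_pos.mpr hgap) (not_le.mp hlt)]
  have hS00 : ∑ p, ‖v p‖ ^ 2 = 0 := le_antisymm hSle hS0
  funext p
  have := (Finset.sum_eq_zero_iff_of_nonneg fun p _ => sq_nonneg ‖v p‖).mp hS00 p (mem_univ p)
  exact norm_eq_zero.mp (pow_eq_zero_iff two_ne_zero |>.mp this)

/-- **Dimension bound from a cutoff.**  Under the hypotheses of `eq_zero_of_localFloor_of_cutoff`,
a subspace `E` of vectors supported in the site set `Z` with `Σ|(Av)_p|² ≤ τ Σ|v_p|²` on `E` has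
`dim E ≤ |κ| · #T` for some `T ⊆ Z ∩ {χ < 1}` (the restriction to `T × κ` is injective on `E`).
[folklore] -/
theorem exists_finrank_le_card_of_cutoff (dist : σ → σ → ℕ) (A : Matrix (σ × κ) (σ × κ) ℂ)
    (hrange : ∀ p q, A p q ≠ 0 → dist p.1 q.1 ≤ 1) (h : ℝ) (hh : 0 ≤ h)
    (hrow : ∀ p, ∑ q ∈ univ.filter (fun q => dist p.1 q.1 ≠ 0), ‖A p q‖ ≤ h)
    (hcol : ∀ q, ∑ p ∈ univ.filter (fun p => dist p.1 q.1 ≠ 0), ‖A p q‖ ≤ h)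
    (χ : σ → ℝ) (hχ01 : ∀ x, 0 ≤ χ x ∧ χ x ≤ 1) {η : ℝ} (hη : 0 ≤ η)
    (hχ : ∀ x y, |χ y - χ x| ≤ η * dist x y) (F τ : ℝ) (hgap : 2 * τ + 2 * (η * h) ^ 2 < F)
    (hfloor : ∀ w : σ × κ → ℂ, (∀ p, w p ≠ 0 → χ p.1 ≠ 0) →
      F * ∑ p, ‖w p‖ ^ 2 ≤ ∑ p, ‖(A *ᵥ w) p‖ ^ 2)
    (Z : Finset σ) (E : Submodule ℂ (σ × κ → ℂ)) (hEZ : ∀ v ∈ E, ∀ x ∉ Z, ∀ k, v (x, k) = 0)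
    (hEτ : ∀ v ∈ E, ∑ p, ‖(A *ᵥ v) p‖ ^ 2 ≤ τ * ∑ p, ‖v p‖ ^ 2) :
    ∃ T : Finset σ, (∀ x ∈ T, x ∈ Z ∧ χ x < 1) ∧
      Module.finrank ℂ E ≤ Fintype.card κ * T.card := by
  classical
  set T : Finset σ := Z.filter fun x => χ x < 1 with hT
  refine ⟨T, fun x hx => by simpa [hT] using hx, ?_⟩
  have hcard : (T ×ˢ (univ : Finset κ)).card = Fintype.card κ * T.card := by
    rw [card_product, card_univ, mul_comm]
  rw [← hcard]
  refine finrank_le_card_of_forall_eq_zero E _ fun v hv hvS => ?_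
  refine eq_zero_of_localFloor_of_cutoff dist A hrange h hh hrow hcol χ hχ01 hη hχ F τ hgap hfloor
    v (hEτ v hv) fun p hp => ?_
  have hpZ : p.1 ∈ Z := by
    by_contra hx
    exact hp (hEZ v hv p.1 hx p.2)
  have hχp : ¬ χ p.1 < 1 := fun hlt =>
    hp (hvS p (mem_product.mpr ⟨mem_filter.mpr ⟨hpZ, hlt⟩, mem_univ _⟩))
  exact le_antisymm (hχ01 p.1).2 (not_lt.mp hχp)

/-! ### The clamped distance to the rough set -/

omit [Fintype σ] [Fintype κ] in
/-- **A Lipschitz cutoff adapted to a rough set.**  For a symmetric `dist` with the triangle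
inequality, a finite rough set `Rgh`, a radius `r` and a width `ℓ ≥ 1` there is
`χ : σ → [0, 1]`, `(1/ℓ)`-Lipschitz, vanishing within distance `r` of `Rgh` and equal to `1`
off the `(r + ℓ)`-collar of `Rgh`: `χ(x) = min(ℓ, (dist(x, Rgh) − r)₊)/ℓ` (and `χ ≡ 1` if
`Rgh = ∅`). [folklore] -/
theorem exists_lipschitz_cutoff (dist : σ → σ → ℕ) (hds : ∀ x y, dist x y = dist y x)
    (hdt : ∀ x y z, dist x z ≤ dist x y + dist y z) (Rgh : Finset σ) (r ℓ : ℕ) (hℓ : 0 < ℓ) :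
    ∃ χ : σ → ℝ, (∀ x, 0 ≤ χ x ∧ χ x ≤ 1) ∧ (∀ x y, |χ y - χ x| ≤ 1 / (ℓ : ℝ) * dist x y) ∧
      (∀ x, χ x ≠ 0 → ∀ y ∈ Rgh, r < dist x y) ∧
      (∀ x, χ x < 1 → ∃ y ∈ Rgh, dist x y < r + ℓ) := by
  have hℓr : (0 : ℝ) < ℓ := by exact_mod_cast hℓ
  rcases Rgh.eq_empty_or_nonempty with hRe | hne
  · refine ⟨fun _ => 1, fun _ => ⟨zero_le_one, le_rfl⟩, fun x y => ?_, fun x _ y hy => ?_,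
      fun x hx => (lt_irrefl _ hx).elim⟩
    · rw [sub_self, abs_zero]; positivity
    · rw [hRe] at hy; simp at hy
  -- the distance to the rough set and its clamp
  set d : σ → ℕ := fun x => Rgh.inf' hne (dist x) with hd
  have hdle : ∀ x, ∀ y ∈ Rgh, d x ≤ dist x y := fun x y hy => Finset.inf'_le _ hy
  have hdex : ∀ x, ∃ y ∈ Rgh, dist x y = d x := fun x => by
    obtain ⟨y, hy, h⟩ := Finset.exists_mem_eq_inf' hne (dist x)
    exact ⟨y, hy, h.symm⟩
  have hdlip : ∀ x y, d y ≤ d x + dist x y := by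
    intro x y
    obtain ⟨z, hz, hxz⟩ := hdex x
    calc d y ≤ dist y z := hdle y z hz
      _ ≤ dist y x + dist x z := hdt y x z
      _ = d x + dist x y := by rw [hxz, hds y x, add_comm]
  set n : σ → ℕ := fun x => min ℓ (d x - r) with hn
  have hnle : ∀ x, n x ≤ ℓ := fun x => min_le_left _ _
  have hnlip : ∀ x y, n y ≤ n x + dist x y := by
    intro x y
    have := hdlip x y
    simp only [hn]
    omega
  refine ⟨fun x => (n x : ℝ) / ℓ, fun x => ⟨by positivity, ?_⟩, fun x y => ?_, fun x hx y hy => ?_,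
    fun x hx => ?_⟩
  · rw [div_le_one hℓr]; exact_mod_cast hnle x
  · rw [← sub_div, abs_div, abs_of_pos hℓr, div_le_iff₀ hℓr,
      show 1 / (ℓ : ℝ) * dist x y * ℓ = dist x y by field_simp]
    have h1 : (n y : ℝ) ≤ n x + dist x y := by exact_mod_cast hnlip x y
    have h2 : (n x : ℝ) ≤ n y + dist y x := by exact_mod_cast hnlip y x
    rw [hds y x] at h2
    rw [abs_le]
    constructor <;> linarith
  · have hn0 : n x ≠ 0 := by
      intro h0
      apply hx
      simp only [h0, Nat.cast_zero, zero_div]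
    have : r < d x := by
      simp only [hn] at hn0
      omega
    exact this.trans_le (hdle x y hy)
  · have hnlt : n x < ℓ := by
      by_contra hge
      have heq : n x = ℓ := le_antisymm (hnle x) (not_lt.mp hge)
      apply (lt_irrefl (1 : ℝ))
      calc (1 : ℝ) = (n x : ℝ) / ℓ := by rw [heq, div_self hℓr.ne']
        _ < 1 := hx
    have hdx : d x < r + ℓ := by
      simp only [hn] at hnlt
      omega
    obtain ⟨y, hy, hxy⟩ := hdex x
    exact ⟨y, hy, hxy ▸ hdx⟩

/-! ### The dimension bound -/

/-- **Local, volume-free dimension bound below a local floor.**  Let `dist` be a symmetric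
`ℕ`-valued distance on the finite site set `σ` with the triangle inequality, `A` a matrix on
`σ × κ` of range one in the sites with off-site absolute row and column sums `≤ h`, and suppose
the LOCAL FLOOR `F Σ|w_p|² ≤ Σ|(Aw)_p|²` for every `w` all of whose sites are at distance `> r`
from every rough site.  If `2τ + 2(h/ℓ)² < F` (`ℓ ≥ 1`), then every subspace `E` of vectors
supported in the site set `Z` with `Σ|(Av)_p|² ≤ τ Σ|v_p|²` on `E` satisfies
`dim E ≤ |κ| · #T` for some `T ⊆ {x ∈ Z | ∃ y rough, dist x y < r + ℓ}`: the rank of the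
sub-threshold block supported in `Z` is carried by the `(r + ℓ)`-collar of the rough set inside
`Z`, uniformly in `|σ|` (IMS localisation with the cutoff of `exists_lipschitz_cutoff`, Schur's
test for the commutator, injectivity of the restriction map). [folklore] -/
theorem exists_finrank_le_card_of_localFloor (dist : σ → σ → ℕ)
    (hds : ∀ x y, dist x y = dist y x) (hdt : ∀ x y z, dist x z ≤ dist x y + dist y z)
    (A : Matrix (σ × κ) (σ × κ) ℂ) (hrange : ∀ p q, A p q ≠ 0 → dist p.1 q.1 ≤ 1)
    (h : ℝ) (hh : 0 ≤ h)
    (hrow : ∀ p, ∑ q ∈ univ.filter (fun q => dist p.1 q.1 ≠ 0), ‖A p q‖ ≤ h)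
    (hcol : ∀ q, ∑ p ∈ univ.filter (fun p => dist p.1 q.1 ≠ 0), ‖A p q‖ ≤ h)
    (rough : σ → Prop) (r : ℕ) (F τ : ℝ) (ℓ : ℕ) (hℓ : 0 < ℓ)
    (hgap : 2 * τ + 2 * (h / ℓ) ^ 2 < F)
    (hfloor : ∀ w : σ × κ → ℂ, (∀ p, w p ≠ 0 → ∀ y, rough y → r < dist p.1 y) →
      F * ∑ p, ‖w p‖ ^ 2 ≤ ∑ p, ‖(A *ᵥ w) p‖ ^ 2)
    (Z : Finset σ) (E : Submodule ℂ (σ × κ → ℂ)) (hEZ : ∀ v ∈ E, ∀ x ∉ Z, ∀ k, v (x, k) = 0)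
    (hEτ : ∀ v ∈ E, ∑ p, ‖(A *ᵥ v) p‖ ^ 2 ≤ τ * ∑ p, ‖v p‖ ^ 2) :
    ∃ T : Finset σ, (∀ x ∈ T, x ∈ Z ∧ ∃ y, rough y ∧ dist x y < r + ℓ) ∧
      Module.finrank ℂ E ≤ Fintype.card κ * T.card := by
  classical
  obtain ⟨χ, hχ01, hχlip, hχ0, hχ1⟩ :=
    exists_lipschitz_cutoff dist hds hdt (univ.filter rough) r ℓ hℓ
  have hη : (0 : ℝ) ≤ 1 / ℓ := by positivity
  have hgap' : 2 * τ + 2 * (1 / (ℓ : ℝ) * h) ^ 2 < F := by rwa [one_div_mul_eq_div]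
  have hfloorχ : ∀ w : σ × κ → ℂ, (∀ p, w p ≠ 0 → χ p.1 ≠ 0) →
      F * ∑ p, ‖w p‖ ^ 2 ≤ ∑ p, ‖(A *ᵥ w) p‖ ^ 2 := fun w hw =>
    hfloor w fun p hp y hy => hχ0 p.1 (hw p hp) y (mem_filter.mpr ⟨mem_univ y, hy⟩)
  obtain ⟨T, hT, hfin⟩ := exists_finrank_le_card_of_cutoff dist A hrange h hh hrow hcol χ hχ01 hη
    hχlip F τ hgap' hfloorχ Z E hEZ hEτ
  refine ⟨T, fun x hx => ⟨(hT x hx).1, ?_⟩, hfin⟩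
  obtain ⟨y, hy, hxy⟩ := hχ1 x (hT x hx).2
  exact ⟨y, (mem_filter.mp hy).2, hxy⟩

end Cutoff

end Literature.Analysis.Matrix
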